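import Literature.NumberTheory.Transcendental.PhilipponZeroEstimateStd
import Mathlib.Analysis.Complex.CauchyIntegral
import Mathlib.Analysis.SpecialFunctions.ExpDeriv
import Mathlib.Analysis.Analytic.Linear
import HarnessLib

/-!
# The theta functions of `M_κ` are analytic on `Lie M_κ,ℂ`

Topic: `Literature/NumberTheory/Transcendental`. Plan item W4/S5(a) of the unit
`provefact-Literature.NumberTheory.Transcendental.H-b596640137`. `PkappaTheta.lean` proved that the
theta functions `GaGmE.Std.theta L κ J : (β ⊕ (γ ⊕ δ) → ℂ) → ℂ` and the forms `thetaEval` are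
complex-DIFFERENTIABLE. The extrapolation step of Baker's method manipulates their higher mixed
derivatives (`iteratedFDeriv`, symmetric for analytic maps:
Mathlib's `ContDiffAt.iteratedFDeriv_comp_perm`), so we need them ANALYTIC on the finite
dimensional space `Lie M_κ,ℂ` — which, in several complex variables, Mathlib does not derive from
differentiability. PROVED here structurally: each theta function is a polynomial in
`e^{y'_j}`, `σ^{(n)}(z'_b)` (`n ≤ 3`) and `s'_e`, i.e. in entire functions of ONE variable
composed with coordinate projections (`analyticAt_sigmaDeriv_comp`, `analyticAt_univExtP_comp`, …),
hence analytic (`analyticAt_theta`, `analyticOnNhd_thetaEval`, `contDiff_thetaEval`).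

## References

* A. Baker, G. Wüstholz, *Logarithmic Forms and Diophantine Geometry*, CUP 2007, §6.8.
-/

noncomputable section

open Complex Set
open scoped PeriodPair ContDiff

namespace Literature.NumberTheory.Transcendental

namespace GaGmE

namespace Std

variable {β γ δ : Type} [Fintype β] [Fintype γ] [Fintype δ] [DecidableEq γ]
variable (L : PeriodPair) (κM : δ → γ → Kbar)

/-! ### One-variable entire functions of a coordinate -/

omit [DecidableEq γ] in
/-- A coordinate `w ↦ w k` is analytic. [folklore] -/
theorem analyticAt_coord (k : β ⊕ (γ ⊕ δ)) (w : β ⊕ (γ ⊕ δ) → ℂ) :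
    AnalyticAt ℂ (fun w : β ⊕ (γ ⊕ δ) → ℂ => w k) w :=
  (ContinuousLinearMap.proj (R := ℂ) (φ := fun _ : β ⊕ (γ ⊕ δ) => ℂ) k).analyticAt w

omit [DecidableEq γ] in
/-- An entire function of one variable composed with a coordinate is analytic. [folklore] -/
theorem analyticAt_comp_coord {f : ℂ → ℂ} (hf : Differentiable ℂ f) (k : β ⊕ (γ ⊕ δ))
    (w : β ⊕ (γ ⊕ δ) → ℂ) : AnalyticAt ℂ (fun w : β ⊕ (γ ⊕ δ) → ℂ => f (w k)) w := by
  have h := AnalyticAt.comp (g := f) (f := fun w : β ⊕ (γ ⊕ δ) → ℂ => w k) (x := w)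
    (hf.analyticAt (w k)) (analyticAt_coord k w)
  exact h

omit [DecidableEq γ] in
/-- `w ↦ σ^{(n)}(z'_b(w))` is analytic. [folklore] -/
theorem analyticAt_sigmaDeriv_comp (n : ℕ) (b : γ) (w : β ⊕ (γ ⊕ δ) → ℂ) :
    AnalyticAt ℂ (fun w : β ⊕ (γ ⊕ δ) → ℂ => L.sigmaDeriv n (w (iz b))) w :=
  analyticAt_comp_coord (L.differentiable_sigmaDeriv n) (iz b) w

omit [DecidableEq γ] in
/-- `w ↦ P_i(z'_b(w))` is analytic. [folklore] -/
theorem analyticAt_univExtP_comp (i : Fin 3) (b : γ) (w : β ⊕ (γ ⊕ δ) → ℂ) :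
    AnalyticAt ℂ (fun w : β ⊕ (γ ⊕ δ) → ℂ => L.univExtP i (w (iz b))) w :=
  analyticAt_comp_coord (L.differentiable_univExtP i) (iz b) w

omit [DecidableEq γ] in
/-- `w ↦ Z_i(z'_b(w))` is analytic. [folklore] -/
theorem analyticAt_univExtZ_comp (i : Fin 3) (b : γ) (w : β ⊕ (γ ⊕ δ) → ℂ) :
    AnalyticAt ℂ (fun w : β ⊕ (γ ⊕ δ) → ℂ => L.univExtZ i (w (iz b))) w :=
  analyticAt_comp_coord (L.differentiable_univExtZ i) (iz b) w

/-! ### The theta functions -/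

omit [DecidableEq γ] in
/-- `Θ^P_{(M, none)}` is analytic. [folklore] -/
theorem analyticAt_thetaPnone (M : γ → Fin 3) (w : β ⊕ (γ ⊕ δ) → ℂ) :
    AnalyticAt ℂ (thetaPnone (β := β) (δ := δ) L M) w := by
  have : thetaPnone (β := β) (δ := δ) L M = fun w => ∏ b, L.univExtP (M b) (w (iz b)) := rfl
  rw [this]
  exact Finset.univ.analyticAt_fun_prod fun b _ => analyticAt_univExtP_comp L (M b) b w

/-- `Θ^P_{(M, some e)}` is analytic. [folklore] -/
theorem analyticAt_thetaPsome (M : γ → Fin 3) (e : δ) (w : β ⊕ (γ ⊕ δ) → ℂ) :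
    AnalyticAt ℂ (thetaPsome (β := β) L κM M e) w := by
  have : thetaPsome (β := β) L κM M e = fun w => w (is e) * thetaPnone L M w -
      ∑ b, (κM e b : ℂ) * (L.univExtZ (M b) (w (iz b)) *
        ∏ b' ∈ Finset.univ.erase b, L.univExtP (M b') (w (iz b'))) := rfl
  rw [this]
  refine ((analyticAt_coord (is e) w).mul (analyticAt_thetaPnone L M w)).sub ?_
  refine Finset.analyticAt_fun_sum _ fun b _ => analyticAt_const.mul ?_
  exact (analyticAt_univExtZ_comp L (M b) b w).mul
    ((Finset.univ.erase b).analyticAt_fun_prod fun b' _ => analyticAt_univExtP_comp L (M b') b' w)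

/-- The theta functions of `P_κ` are analytic. [folklore] -/
theorem analyticAt_thetaP (I : ThetaIdx γ δ) (w : β ⊕ (γ ⊕ δ) → ℂ) :
    AnalyticAt ℂ (thetaP (β := β) L κM I) w := by
  obtain ⟨M, _ | e⟩ := I
  · exact analyticAt_thetaPnone L M w
  · exact analyticAt_thetaPsome L κM M e w

omit [DecidableEq γ] in
/-- The torus coordinates are analytic. [folklore] -/
theorem analyticAt_thetaT (a : Option β) (w : β ⊕ (γ ⊕ δ) → ℂ) :
    AnalyticAt ℂ (thetaT (γ := γ) (δ := δ) a) w := by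
  rcases a with _ | j
  · exact analyticAt_const
  · exact (analyticAt_coord (iy j) w).cexp'

/-- **The theta functions of `M_κ` are analytic.** [folklore] -/
theorem analyticAt_theta (J : Option β × ThetaIdx γ δ) (w : β ⊕ (γ ⊕ δ) → ℂ) :
    AnalyticAt ℂ (theta L κM J) w :=
  (analyticAt_thetaT J.1 w).mul (analyticAt_thetaP L κM J.2 w)

/-- The theta functions are analytic on the whole space. [folklore] -/
theorem analyticOnNhd_theta (J : Option β × ThetaIdx γ δ) : AnalyticOnNhd ℂ (theta L κM J) univ :=
  fun w _ => analyticAt_theta L κM J w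

/-- **The forms `F_P = P(Θ)` are analytic.** [folklore] -/
theorem analyticAt_thetaEval (P : MvPolynomial (Option β × ThetaIdx γ δ) ℂ) (w : β ⊕ (γ ⊕ δ) → ℂ) :
    AnalyticAt ℂ (thetaEval L κM P) w := by
  unfold thetaEval
  induction P using MvPolynomial.induction_on with
  | C a => simpa using analyticAt_const
  | add p q hp hq =>
    simp only [map_add]
    exact hp.add hq
  | mul_X p J hp =>
    simp only [map_mul, MvPolynomial.eval_X]
    exact hp.mul (analyticAt_theta L κM J w)

/-- `F_P` is analytic on the whole space. [folklore] -/
theorem analyticOnNhd_thetaEval (P : MvPolynomial (Option β × ThetaIdx γ δ) ℂ) :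
    AnalyticOnNhd ℂ (thetaEval L κM P) univ :=
  fun w _ => analyticAt_thetaEval L κM P w

/-- `F_P` is `C^ω`. [folklore] -/
theorem contDiff_thetaEval (P : MvPolynomial (Option β × ThetaIdx γ δ) ℂ) :
    ContDiff ℂ ω (thetaEval L κM P) :=
  (analyticOnNhd_thetaEval L κM P).contDiff

end Std

end GaGmE

end Literature.NumberTheory.Transcendental

end
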